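import Summits.QuantumFields.GaugeBoot.TiltedRPPositivity
import HarnessLib

/-!
# Diagonal reflection positivity on the 45°-tilted periodic box (gauge-boot, L3(σ) part 6 — the theorem)

HONEST FRAMING (cell `pub-gaugeboot`, page 1 of every file): the venture produces certified bounds
on lattice expectations at stated coupling, gauge group, dimension and torus size; NOT a mass gap,
NOT a continuum limit, NOT a string tension; NOT Yang–Mills-summit-bearing (barriers
`FixedCouplingUltralocality`, `PerturbativeInvisibility`).

**The tilted box.** For a dimension `d`, two directions `i ≠ j` and periods `M_u, M_v, L ≥ 1`, the
45°-TILTED PERIODIC BOX of Fröhlich–Israel–Lieb–Simon (J. Stat. Phys. 22 (1980) 297, §3, Model 3.1: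
"the usual finite-volume cutoffs destroy this RP, but we can pick cutoffs which preserve this RP at
the cost of losing the other RP; namely one takes a periodic box with sides at 45°") is the periodic
lattice `TiltedSite d i j M_u M_v L = ℤ^d / Γ`,
`Γ = {x ∈ ℤ^d : 2M_u ∣ x_i + x_j, 2M_v ∣ x_i - x_j, L ∣ x_k (k ∉ {i, j})}` (`mem_tiltedLattice_iff`):
periodic with period `2M_u` along `e_i + e_j`, `2M_v` along `e_i - e_j` (the two sides at 45° in the
`(i, j)`-plane) and `L` along the remaining axes; finitely many sites (`2 M_u M_v L^{d-2}` of
them; `Fintype` via the injection into `ℤ/2M_u × ℤ/2M_v × (ℤ/L)^d`). Its marked translations are `tiltedUnit k = [e_k]`, its diagonal mirror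
`tiltedMirror = [x ↦ x ∘ (i j)]` and its height `tiltedHeight = [x ↦ x_i - x_j mod 2M_v]`; for
`M_v ≥ 2` these form a tilted diagonal frame (`isTiltedFrame_tiltedBox`): the point is that
`x - θx = (x_i - x_j)(e_i - e_j) ∈ Γ` whenever `M_v ∣ x_i - x_j`, so BOTH layers `v = 0` and `v = M_v`
of the box are pointwise fixed by the mirror — exactly the property the cubic torus `(ℤ/L)^d` lacks
(`DiagonalRPTorusNegative.lean`: its back layer is mapped to itself but not pointwise, and
diagonal RP fails there at every `β`, in every `d ≥ 2`).

**Theorem (`tiltedBox_diagonalRP`).** For every compact second countable group `G`, continuous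
matrix representation `ρ`, `β ≥ 0`, `i ≠ j`, `M_u, L ≥ 1`, `M_v ≥ 2`: the Wilson lattice gauge
theory `μ_β = Z⁻¹ exp(-β ∑_p (N - Re tr ρ(U_p))) ∏_links dU` on the tilted box is REFLECTION POSITIVE
in the diagonal hyperplane `x_i = x_j`: `0 ≤ ∫ conj F(ΘU) · F(U) dμ_β(U)` for every bounded measurable
`F` depending only on the links with both endpoints in the closed half `{0 ≤ x_i - x_j ≤ M_v}`
(`Θ U (x, k) = U(θx, (i j) k)`). Equivalently (`tiltedBox_rDiagBlock_nonneg`) the bootstrap's diagonal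
positivity matrices `(⟨conj(F_a ∘ Θ) F_b⟩_β)_{a,b}` are positive semidefinite on this family of finite
periodic lattices — Kazakov–Zheng's third reflection-positivity family (arXiv:2203.11360 §3.1,
arXiv:2404.16925 §3.2; Guo–Li–Yang–Zhu arXiv:2502.14421 p. 16, the `R₂` mirror) holds EXACTLY here,
with no infinite-volume or uniqueness hypothesis. The Wilson measure of the box is moreover
`Θ`-invariant (`tiltedBox_integral_comp_configSwap`). The anti-diagonal mirror `x_i = -x_j`
(conjugate to `Θ` by the symmetry `x_j ↦ -x_j` of `Γ`, which reverses the `j`-links) and the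
translates of the two hyperplanes (translation invariance, `TiltedLatticeSymmetry.lean`) are NOT
spelled out here; the coordinate reflections `x_i ↦ -x_i` alone are not reflection symmetries of
positive type of this box (FILS: "at the cost of losing the other RP" in the `(i, j)`-plane), while
site/link RP along the axes `k ∉ {i, j}` are the usual torus statements (not treated here).

Proof: `IsTiltedFrame.integral_conj_mul_nonneg` (`TiltedRPPositivity.lean`, Osterwalder–Seiler
1978 §2 mechanism via the tree's `LatticeRP.integral_mul_conj_mul_exp_nonneg_of_shared`) applied to
the frame of the box. This is the cell's task L3 ("diagonal-plane RP for the Wilson action in the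
tree's torus setting — enlarges 𝓟") in the only periodic setting where it is TRUE, and the tree
theorem the tribunal's pointer P-R1 (HOME/tribunal/t2-rerun-2026-08-27.md; t1.md v2.1 A4) made the
honest finite-volume family rung conditional on. NEW AS A THEOREM for lattice gauge theories as far
as the cell's searches go; the phenomenon and the box are folklore-in-print (FILS 1980 §3).

References: J. Fröhlich, R. Israel, E. H. Lieb, B. Simon, J. Stat. Phys. 22 (1980) 297, §3, and
Comm. Math. Phys. 62 (1978) 1, Thm. 2.1; K. Osterwalder, E. Seiler, Ann. Phys. 110 (1978) 440, §2;
V. Kazakov, Z. Zheng, arXiv:2203.11360 §3.1, arXiv:2404.16925 §3.2; M. Biskup, in LNM 1970 (2009) §5.4 (the "diagonal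
torus" of nearest-neighbour spin systems = this tilted box; tribunal t2 F-R5/P-R1).
-/

noncomputable section

open MeasureTheory Complex QuotientAddGroup
open scoped ComplexOrder ComplexConjugate

namespace Summit.QuantumFields.GaugeBoot

namespace TiltedRP

/-! ## The tilted lattice `Γ` and the box `ℤ^d / Γ` -/

section Box

variable (d : ℕ) (i j : Fin d) (Mu Mv L : ℕ)

/-- `x ↦ x_i + x_j mod 2M_u`. -/
def sumHom : (Fin d → ℤ) →+ ZMod (2 * Mu) :=
  (Int.castAddHom (ZMod (2 * Mu))).comp
    (Pi.evalAddMonoidHom (fun _ : Fin d => ℤ) i + Pi.evalAddMonoidHom (fun _ : Fin d => ℤ) j)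

/-- `x ↦ x_i - x_j mod 2M_v` (the height before passing to the quotient). -/
def diffHom : (Fin d → ℤ) →+ ZMod (2 * Mv) :=
  (Int.castAddHom (ZMod (2 * Mv))).comp
    (Pi.evalAddMonoidHom (fun _ : Fin d => ℤ) i - Pi.evalAddMonoidHom (fun _ : Fin d => ℤ) j)

/-- `x ↦ (x_k mod L)_{k ∉ {i, j}}` (the components `i, j` are sent to `0`). -/
def restHom : (Fin d → ℤ) →+ (Fin d → ZMod L) :=
  AddMonoidHom.pi fun k => if k = i ∨ k = j then 0 else
    (Int.castAddHom (ZMod L)).comp (Pi.evalAddMonoidHom (fun _ : Fin d => ℤ) k)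

/-- The homomorphism `ℤ^d → ℤ/2M_u × ℤ/2M_v × (ℤ/L)^d` whose kernel is the tilted lattice `Γ`. -/
def tiltedHom : (Fin d → ℤ) →+ ZMod (2 * Mu) × ZMod (2 * Mv) × (Fin d → ZMod L) :=
  (sumHom d i j Mu).prod ((diffHom d i j Mv).prod (restHom d i j L))

/-- The tilted lattice `Γ = {x : 2M_u ∣ x_i + x_j, 2M_v ∣ x_i - x_j, L ∣ x_k (k ∉ {i, j})}` of
Fröhlich–Israel–Lieb–Simon's periodic box with sides at 45° in the `(i, j)`-plane. -/
def tiltedLattice : AddSubgroup (Fin d → ℤ) := (tiltedHom d i j Mu Mv L).ker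

/-- **The 45°-tilted periodic box** `ℤ^d / Γ`. -/
abbrev TiltedSite : Type := (Fin d → ℤ) ⧸ tiltedLattice d i j Mu Mv L

/-- Membership in `Γ`, as congruences. -/
theorem mem_tiltedLattice_iff_cast (x : Fin d → ℤ) : x ∈ tiltedLattice d i j Mu Mv L ↔
    ((x i + x j : ℤ) : ZMod (2 * Mu)) = 0 ∧ ((x i - x j : ℤ) : ZMod (2 * Mv)) = 0 ∧
      ∀ k, k ≠ i → k ≠ j → ((x k : ℤ) : ZMod L) = 0 := by
  rw [tiltedLattice, AddMonoidHom.mem_ker]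
  simp only [tiltedHom, sumHom, diffHom, restHom, AddMonoidHom.prod_apply, Prod.mk_eq_zero,
    AddMonoidHom.coe_comp, Function.comp_apply, AddMonoidHom.add_apply, AddMonoidHom.sub_apply,
    Pi.evalAddMonoidHom_apply, Int.coe_castAddHom]
  constructor
  · rintro ⟨h1, h2, h3⟩
    refine ⟨h1, h2, fun k hki hkj => ?_⟩
    have h := congrFun h3 k
    simp only [AddMonoidHom.pi_apply, hki, hkj, or_self, ↓reduceIte, AddMonoidHom.coe_comp,
      Function.comp_apply, Pi.evalAddMonoidHom_apply, Int.coe_castAddHom, Pi.zero_apply] at h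
    exact h
  · rintro ⟨h1, h2, h3⟩
    refine ⟨h1, h2, ?_⟩
    funext k
    simp only [AddMonoidHom.pi_apply, Pi.zero_apply]
    split_ifs with hk
    · rfl
    · rw [not_or] at hk
      simpa using h3 k hk.1 hk.2

/-- **Membership in `Γ`, as divisibilities**: `x ∈ Γ ↔ 2M_u ∣ x_i + x_j ∧ 2M_v ∣ x_i - x_j ∧
L ∣ x_k` for `k ∉ {i, j}`. -/
theorem mem_tiltedLattice_iff (x : Fin d → ℤ) : x ∈ tiltedLattice d i j Mu Mv L ↔
    ((2 * Mu : ℕ) : ℤ) ∣ x i + x j ∧ ((2 * Mv : ℕ) : ℤ) ∣ x i - x j ∧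
      ∀ k, k ≠ i → k ≠ j → (L : ℤ) ∣ x k := by
  rw [mem_tiltedLattice_iff_cast]
  simp only [ZMod.intCast_zmod_eq_zero_iff_dvd]

/-- The box is finite (it maps injectively into `ℤ/2M_u × ℤ/2M_v × (ℤ/L)^d`). -/
theorem finite_tiltedSite [NeZero Mu] [NeZero Mv] [NeZero L] : Finite (TiltedSite d i j Mu Mv L) := by
  haveI : NeZero (2 * Mu) := ⟨by have := NeZero.ne Mu; omega⟩
  haveI : NeZero (2 * Mv) := ⟨by have := NeZero.ne Mv; omega⟩
  exact Finite.of_equiv _ (QuotientAddGroup.quotientKerEquivRange (tiltedHom d i j Mu Mv L)).symm.toEquiv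

/-- The box has finitely many sites. -/
instance instFintypeTiltedSite [NeZero Mu] [NeZero Mv] [NeZero L] :
    Fintype (TiltedSite d i j Mu Mv L) :=
  haveI := finite_tiltedSite d i j Mu Mv L
  Fintype.ofFinite _

/-! ## Translations, mirror and height of the box -/

/-- The marked translations of the box: the classes of the unit vectors `e_k`. -/
def tiltedUnit (k : Fin d) : TiltedSite d i j Mu Mv L :=
  ((Pi.single k (1 : ℤ) : Fin d → ℤ) : TiltedSite d i j Mu Mv L)

/-- The coordinate swap `x ↦ x ∘ (i j)` of `ℤ^d`. -/
def swapHom : (Fin d → ℤ) →+ (Fin d → ℤ) where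
  toFun x := x ∘ Equiv.swap i j
  map_zero' := rfl
  map_add' _ _ := rfl

/-- `swapHom` evaluated. -/
@[simp] theorem swapHom_apply (x : Fin d → ℤ) (k : Fin d) :
    swapHom d i j x k = x (Equiv.swap i j k) := rfl

/-- `Γ` is swap invariant. -/
theorem tiltedLattice_le_comap :
    tiltedLattice d i j Mu Mv L ≤ (tiltedLattice d i j Mu Mv L).comap (swapHom d i j) := by
  intro x hx
  rw [AddSubgroup.mem_comap, mem_tiltedLattice_iff_cast]
  rw [mem_tiltedLattice_iff_cast] at hx
  obtain ⟨h1, h2, h3⟩ := hx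
  simp only [swapHom_apply, Equiv.swap_apply_left, Equiv.swap_apply_right]
  refine ⟨by rwa [add_comm], ?_, fun k hki hkj => ?_⟩
  · have : ((x j - x i : ℤ) : ZMod (2 * Mv)) = -((x i - x j : ℤ) : ZMod (2 * Mv)) := by
      push_cast; ring
    rw [this, h2, neg_zero]
  · rw [Equiv.swap_apply_of_ne_of_ne hki hkj]; exact h3 k hki hkj

/-- **The diagonal mirror of the box**: `[x] ↦ [x ∘ (i j)]`. -/
def tiltedMirror : TiltedSite d i j Mu Mv L →+ TiltedSite d i j Mu Mv L :=
  QuotientAddGroup.map _ _ (swapHom d i j) (tiltedLattice_le_comap d i j Mu Mv L)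

/-- **The height of the box**: `[x] ↦ x_i - x_j mod 2M_v`. -/
def tiltedHeight : TiltedSite d i j Mu Mv L →+ ZMod (2 * Mv) :=
  QuotientAddGroup.lift _ (diffHom d i j Mv) (by
    intro x hx
    rw [mem_tiltedLattice_iff_cast] at hx
    rw [AddMonoidHom.mem_ker]
    simpa [diffHom] using hx.2.1)

/-- The mirror on classes. -/
theorem tiltedMirror_mk (x : Fin d → ℤ) :
    tiltedMirror d i j Mu Mv L (x : TiltedSite d i j Mu Mv L) =
      ((swapHom d i j x : Fin d → ℤ) : TiltedSite d i j Mu Mv L) := rfl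

/-- The height on classes. -/
theorem tiltedHeight_mk (x : Fin d → ℤ) :
    tiltedHeight d i j Mu Mv L (x : TiltedSite d i j Mu Mv L) = ((x i - x j : ℤ) : ZMod (2 * Mv)) := rfl

/-- The unit vector `e_k` composed with the swap is the unit vector `e_{(i j) k}`. -/
theorem swapHom_single (k : Fin d) :
    swapHom d i j (Pi.single k (1 : ℤ)) = Pi.single (Equiv.swap i j k) (1 : ℤ) := by
  funext m
  simp only [swapHom_apply, Pi.single_apply, Equiv.swap_apply_eq_iff]

/-- **The key property of the box: the layers `x_i - x_j ≡ 0` and `≡ M_v (mod 2M_v)` are pointwise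
fixed by the mirror** — `x - x ∘ (i j) = (x_i - x_j)(e_i - e_j) ∈ Γ` as soon as `M_v ∣ x_i - x_j`. -/
theorem tiltedMirror_eq_self_of_layer (q : TiltedSite d i j Mu Mv L)
    (hq : tiltedHeight d i j Mu Mv L q = 0 ∨
      tiltedHeight d i j Mu Mv L q = ((Mv : ℕ) : ZMod (2 * Mv))) :
    tiltedMirror d i j Mu Mv L q = q := by
  induction q using QuotientAddGroup.induction_on with
  | H x =>
    rw [tiltedMirror_mk, QuotientAddGroup.eq, mem_tiltedLattice_iff]
    rw [tiltedHeight_mk] at hq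
    -- `M_v ∣ x_i - x_j`
    have hdvd : (Mv : ℤ) ∣ x i - x j := by
      rcases hq with h | h
      · have h' := (ZMod.intCast_zmod_eq_zero_iff_dvd _ _).1 h
        exact (Dvd.intro 2 (by push_cast; ring) : (Mv : ℤ) ∣ ((2 * Mv : ℕ) : ℤ)).trans h'
      · have h' : (((x i - x j - Mv : ℤ)) : ZMod (2 * Mv)) = 0 := by
          push_cast at h ⊢
          rw [h, sub_self]
        have h'' := (ZMod.intCast_zmod_eq_zero_iff_dvd _ _).1 h'
        have h3 : (Mv : ℤ) ∣ x i - x j - Mv :=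
          (Dvd.intro 2 (by push_cast; ring) : (Mv : ℤ) ∣ ((2 * Mv : ℕ) : ℤ)).trans h''
        simpa using h3.add (dvd_refl (Mv : ℤ))
    simp only [Pi.neg_apply, Pi.add_apply, swapHom_apply, Equiv.swap_apply_left,
      Equiv.swap_apply_right]
    refine ⟨⟨0, by ring⟩, ?_, fun k hki hkj => ?_⟩
    · obtain ⟨c, hc⟩ := hdvd
      exact ⟨c, by push_cast; linear_combination (2 : ℤ) * hc⟩
    · rw [Equiv.swap_apply_of_ne_of_ne hki hkj, neg_add_cancel]
      exact dvd_zero _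

/-- **The 45°-tilted periodic box carries a tilted diagonal frame** (`i ≠ j`, `M_v ≥ 2`). -/
theorem isTiltedFrame_tiltedBox (hij : i ≠ j) (hMv : 2 ≤ Mv) :
    IsTiltedFrame (tiltedUnit d i j Mu Mv L) i j (tiltedMirror d i j Mu Mv L) Mv
      (tiltedHeight d i j Mu Mv L) where
  ne := hij
  two_le := hMv
  map_e k := by
    show tiltedMirror d i j Mu Mv L ((Pi.single k (1 : ℤ) : Fin d → ℤ) : TiltedSite d i j Mu Mv L) = _
    rw [tiltedMirror_mk, swapHom_single]
    rfl
  invol q := by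
    induction q using QuotientAddGroup.induction_on with
    | H x =>
      rw [tiltedMirror_mk, tiltedMirror_mk]
      congr 1
      funext m
      simp [Equiv.swap_apply_self]
  height_left := by
    show tiltedHeight d i j Mu Mv L ((Pi.single i (1 : ℤ) : Fin d → ℤ) : TiltedSite d i j Mu Mv L) = 1
    rw [tiltedHeight_mk]
    simp [hij.symm]
  height_right := by
    show tiltedHeight d i j Mu Mv L ((Pi.single j (1 : ℤ) : Fin d → ℤ) : TiltedSite d i j Mu Mv L) = -1
    rw [tiltedHeight_mk]
    simp [hij]
  height_other k hki hkj := by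
    show tiltedHeight d i j Mu Mv L ((Pi.single k (1 : ℤ) : Fin d → ℤ) : TiltedSite d i j Mu Mv L) = 0
    rw [tiltedHeight_mk]
    simp [Ne.symm hki, Ne.symm hkj]
  height_map q := by
    induction q using QuotientAddGroup.induction_on with
    | H x =>
      rw [tiltedMirror_mk, tiltedHeight_mk, tiltedHeight_mk]
      simp only [swapHom_apply, Equiv.swap_apply_left, Equiv.swap_apply_right]
      push_cast
      ring
  fix_of_layer q hq := tiltedMirror_eq_self_of_layer d i j Mu Mv L q hq

end Box

/-! ## The theorem -/

section Main

variable {d : ℕ} {i j : Fin d} {Mu Mv L N : ℕ} [NeZero Mu] [NeZero Mv] [NeZero L]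
variable {G : Type*} [Group G] [TopologicalSpace G] [IsTopologicalGroup G] [CompactSpace G]
  [MeasurableSpace G] [BorelSpace G] [SecondCountableTopology G]
variable (ρ : G →* Matrix (Fin N) (Fin N) ℂ)

/-- **Diagonal reflection positivity of lattice Yang–Mills on the 45°-tilted periodic box**
(Fröhlich–Israel–Lieb–Simon 1980 §3 box; Osterwalder–Seiler 1978 §2 mechanism). For a compact
second countable `G`, a continuous representation `ρ`, `β ≥ 0`, `i ≠ j`, `M_v ≥ 2`: for every bounded
measurable `F` on the configurations of the box `ℤ^d/Γ` depending only on the links of the closed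
half `{0 ≤ x_i - x_j ≤ M_v (mod 2M_v)}`,
`0 ≤ ∫ conj F(ΘU) · F(U) dμ_β(U)`, `μ_β` the Wilson measure of the box, `Θ` the diagonal mirror. -/
theorem tiltedBox_diagonalRP (hij : i ≠ j) (hMv : 2 ≤ Mv) (hρ : Continuous ρ) {β : ℝ} (hβ : 0 ≤ β)
    (F : Config (TiltedSite d i j Mu Mv L) d G → ℂ) (hFm : Measurable F)
    (hFb : ∃ C : ℝ, ∀ U, ‖F U‖ ≤ C)
    (hFo : IsHalfObservable (tiltedUnit d i j Mu Mv L) Mv (tiltedHeight d i j Mu Mv L) F) :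
    0 ≤ ∫ U, conj (F (configSwap i j (tiltedMirror d i j Mu Mv L) U)) * F U
      ∂(gibbs ρ (tiltedUnit d i j Mu Mv L) β) :=
  (isTiltedFrame_tiltedBox d i j Mu Mv L hij hMv).integral_conj_mul_nonneg ρ hρ hβ F hFm hFb hFo

/-- **The diagonal RP blocks of the tilted box are positive semidefinite**: for bounded measurable
half-space observables `F_1, …, F_n` and `c ∈ ℂ^n`,
`0 ≤ ∑_{a,b} conj c_a · c_b · ⟨conj(F_a ∘ Θ) F_b⟩_β` — the bootstrap's diagonal positivity matrices
(Kazakov–Zheng's third RP family) are exact constraints on this finite periodic lattice. -/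
theorem tiltedBox_rDiagBlock_nonneg (hij : i ≠ j) (hMv : 2 ≤ Mv) (hρ : Continuous ρ) {β : ℝ}
    (hβ : 0 ≤ β) {n : ℕ} (F : Fin n → Config (TiltedSite d i j Mu Mv L) d G → ℂ)
    (hFm : ∀ a, Measurable (F a)) (hFb : ∀ a, ∃ C : ℝ, ∀ U, ‖F a U‖ ≤ C)
    (hFo : ∀ a, IsHalfObservable (tiltedUnit d i j Mu Mv L) Mv (tiltedHeight d i j Mu Mv L) (F a))
    (c : Fin n → ℂ) :
    0 ≤ ∑ a, ∑ b, conj (c a) * c b *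
      ∫ U, conj (F a (configSwap i j (tiltedMirror d i j Mu Mv L) U)) * F b U
        ∂(gibbs ρ (tiltedUnit d i j Mu Mv L) β) :=
  (isTiltedFrame_tiltedBox d i j Mu Mv L hij hMv).sum_mul_conj_integral_nonneg ρ hρ hβ F hFm hFb
    hFo c

/-- **The Wilson measure of the tilted box is invariant under the diagonal mirror**:
`∫ F(ΘU) dμ_β = ∫ F dμ_β` for measurable real `F` (every real `β`; `i ≠ j`, `M_v ≥ 2`). -/
theorem tiltedBox_integral_comp_configSwap (hij : i ≠ j) (hMv : 2 ≤ Mv) (hρ : Continuous ρ)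
    (β : ℝ) {F : Config (TiltedSite d i j Mu Mv L) d G → ℝ} (hFm : Measurable F) :
    ∫ U, F (configSwap i j (tiltedMirror d i j Mu Mv L) U) ∂(gibbs ρ (tiltedUnit d i j Mu Mv L) β) =
      ∫ U, F U ∂(gibbs ρ (tiltedUnit d i j Mu Mv L) β) :=
  (isTiltedFrame_tiltedBox d i j Mu Mv L hij hMv).integral_comp_configSwap_gibbs ρ hρ β hFm

end Main

end TiltedRP

end Summit.QuantumFields.GaugeBoot
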